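/-
Copyright (c) 2026. All rights reserved.
Released under Apache 2.0 license as described in the file LICENSE.
Authors: abc-iut cell, statement-typer seat abc-iut-L4-t3 (wave 1).
-/
import Mathlib.RingTheory.DedekindDomain.Factorization
import Literature.AnabelianGeometry.AbsoluteAnabelian.ArithmeticLineBundles

/-!
# [AbsTopIII] Definition 5.3 (i)/(ii): orders of fractional ideals at finite places (proof-only toolkit)

S. Mochizuki, *Topics in absolute anabelian geometry III* [MochizukiAbsTopIII2015], Def 5.3 (i), (ii) pp. 122–124.
Second step of the DISCHARGE of `AddMulLineBundleCategoriesEquivalent` (`ArithmeticLineBundles.lean`): the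
trivializations `τ[v]` of a `⊠`-line bundle at the finite `v` are the orders of a fractional ideal of `𝒪_F`, and a
fractional ideal is recovered from its orders. Over Mathlib's `FractionalIdeal.count` (the exponent of `v` in the
factorisation of a fractional ideal of the Dedekind domain `𝒪_F`) and the tree's `ord_v` (`Literature.IUT.LogVolume.ord`):
`count_v(x·𝒪_F) = ord_v(x)`; a nonzero fractional ideal is determined by, and containment is detected by, its orders;
`x ∈ J ⟺ ord_v(x) ≥ count_v(J)` for all `v`. Proof-only (no new notions). Refereed pre-IUT material; nothing here bears
on [IUTchIII] Cor. 3.12.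
-/

set_option autoImplicit false

noncomputable section

open NumberField IsDedekindDomain FractionalIdeal
open scoped nonZeroDivisors

namespace Literature.AnabelianGeometry.AbsoluteAnabelian

namespace LineBundleOrders

variable (F : Type) [Field F] [NumberField F] (v : HeightOneSpectrum (𝓞 F))

/-- `count_v` of a principal integral ideal is `ord_v` of its generator. [cite: MochizukiAbsTopIII2015, Def 5.3 (i) p. 122] -/
theorem count_coeIdeal_span_singleton {r : 𝓞 F} (hr : r ≠ 0) :
    count F v ((Ideal.span {r} : Ideal (𝓞 F)) : FractionalIdeal (𝓞 F)⁰ F) =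
      Literature.IUT.LogVolume.ord F v (r : F) := by
  have hI : (Ideal.span {r} : Ideal (𝓞 F)) ≠ 0 := by
    rw [Ne, Ideal.zero_eq_bot, Ideal.span_singleton_eq_bot]
    exact hr
  rw [count_coe F v hI]
  unfold Literature.IUT.LogVolume.ord
  rw [RingOfIntegers.coe_eq_algebraMap, v.valuation_of_algebraMap, v.intValuation_if_neg hr, WithZero.log_exp,
    neg_neg]

/-- `count_v` of a principal fractional ideal is `ord_v` of its generator: `count_v(x·𝒪_F) = ord_v(x)` (`x ∈ F^×`).
[cite: MochizukiAbsTopIII2015, Def 5.3 (i) p. 122] -/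
theorem count_spanSingleton {x : F} (hx : x ≠ 0) :
    count F v (spanSingleton (𝓞 F)⁰ x) = Literature.IUT.LogVolume.ord F v x := by
  obtain ⟨r, s, hs, rfl⟩ := IsFractionRing.div_surjective (A := 𝓞 F) x
  have hs0 : s ≠ 0 := nonZeroDivisors.ne_zero hs
  have hr : r ≠ 0 := by
    rintro rfl
    simp at hx
  have hrF : (algebraMap (𝓞 F) F r) ≠ 0 := RingOfIntegers.coe_ne_zero_iff.mpr hr
  have hsF : (algebraMap (𝓞 F) F s) ≠ 0 := RingOfIntegers.coe_ne_zero_iff.mpr hs0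
  have h1 : spanSingleton (𝓞 F)⁰ (algebraMap (𝓞 F) F r / algebraMap (𝓞 F) F s) =
      ((Ideal.span {r} : Ideal (𝓞 F)) : FractionalIdeal (𝓞 F)⁰ F) *
        (((Ideal.span {s} : Ideal (𝓞 F)) : FractionalIdeal (𝓞 F)⁰ F))⁻¹ := by
    rw [coeIdeal_span_singleton, coeIdeal_span_singleton, spanSingleton_inv, spanSingleton_mul_spanSingleton,
      div_eq_mul_inv]
  have hr1 : ((Ideal.span {r} : Ideal (𝓞 F)) : FractionalIdeal (𝓞 F)⁰ F) ≠ 0 := by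
    rw [Ne, coeIdeal_eq_zero, Ideal.span_singleton_eq_bot]; exact hr
  have hs1 : (((Ideal.span {s} : Ideal (𝓞 F)) : FractionalIdeal (𝓞 F)⁰ F))⁻¹ ≠ 0 := by
    rw [Ne, inv_eq_zero, coeIdeal_eq_zero, Ideal.span_singleton_eq_bot]; exact hs0
  rw [h1, count_mul F v hr1 hs1, count_inv, count_coeIdeal_span_singleton F v hr,
    count_coeIdeal_span_singleton F v hs0, div_eq_mul_inv,
    Literature.IUT.LogVolume.ord_mul F v hrF (inv_ne_zero hsF), Literature.IUT.LogVolume.ord_inv]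

/-- `count_v` of a translate: `count_v(x·J) = ord_v(x) + count_v(J)`. [cite: MochizukiAbsTopIII2015, Def 5.3 (i) p. 122] -/
theorem count_spanSingleton_mul {x : F} (hx : x ≠ 0) {J : FractionalIdeal (𝓞 F)⁰ F} (hJ : J ≠ 0) :
    count F v (spanSingleton (𝓞 F)⁰ x * J) = Literature.IUT.LogVolume.ord F v x + count F v J := by
  rw [count_mul F v ((spanSingleton_ne_zero_iff).mpr hx) hJ, count_spanSingleton F v hx]

variable {F v}

/-- a nonzero fractional ideal is DETERMINED by its orders. [cite: MochizukiAbsTopIII2015, Def 5.3 (i) p. 122] -/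
theorem eq_of_count_eq {I J : FractionalIdeal (𝓞 F)⁰ F} (hI : I ≠ 0) (hJ : J ≠ 0)
    (h : ∀ v : HeightOneSpectrum (𝓞 F), count F v I = count F v J) : I = J := by
  rw [← finprod_heightOneSpectrum_factorization' F hI, ← finprod_heightOneSpectrum_factorization' F hJ]
  exact finprod_congr fun v => by rw [h v]

/-- a nonnegative power of a prime, as a fractional ideal, is integral (`≤ 1`).
[cite: MochizukiAbsTopIII2015, Def 5.3 (i) p. 122] -/
theorem zpow_le_one (v : HeightOneSpectrum (𝓞 F)) {n : ℤ} (hn : 0 ≤ n) :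
    (v.asIdeal : FractionalIdeal (𝓞 F)⁰ F) ^ n ≤ 1 := by
  obtain ⟨m, rfl⟩ := Int.eq_ofNat_of_zero_le hn
  rw [zpow_natCast, ← coeIdeal_pow]
  exact coeIdeal_le_one

/-- a finite product of nonnegative prime powers is integral (`≤ 1`). [cite: MochizukiAbsTopIII2015, Def 5.3 (i) p. 122] -/
theorem finprod_zpow_le_one (e : HeightOneSpectrum (𝓞 F) → ℤ) (he : ∀ v, 0 ≤ e v) :
    ∏ᶠ v : HeightOneSpectrum (𝓞 F), (v.asIdeal : FractionalIdeal (𝓞 F)⁰ F) ^ e v ≤ 1 := by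
  refine finprod_induction (fun I : FractionalIdeal (𝓞 F)⁰ F => I ≤ 1) le_rfl ?_ fun v => zpow_le_one v (he v)
  intro I J hI hJ
  calc I * J ≤ 1 * J := mul_le_mul_left hI J
    _ ≤ 1 * 1 := mul_le_mul_right hJ 1
    _ = 1 := one_mul 1

/-- a finite product of prime powers is nonzero. [cite: MochizukiAbsTopIII2015, Def 5.3 (i) p. 122] -/
theorem finprod_zpow_ne_zero (e : HeightOneSpectrum (𝓞 F) → ℤ) :
    ∏ᶠ v : HeightOneSpectrum (𝓞 F), (v.asIdeal : FractionalIdeal (𝓞 F)⁰ F) ^ e v ≠ 0 := by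
  refine finprod_induction (fun I : FractionalIdeal (𝓞 F)⁰ F => I ≠ 0) one_ne_zero (fun I J hI hJ => mul_ne_zero hI hJ)
    fun v => zpow_ne_zero _ (coeIdeal_ne_zero.mpr v.ne_bot)

/-- CONTAINMENT is detected by orders: `count_v(J) ≤ count_v(I)` for all `v` implies `I ⊆ J`.
[cite: MochizukiAbsTopIII2015, Def 5.3 (i) p. 123] -/
theorem le_of_count_le {I J : FractionalIdeal (𝓞 F)⁰ F} (hI : I ≠ 0) (hJ : J ≠ 0)
    (h : ∀ v : HeightOneSpectrum (𝓞 F), count F v J ≤ count F v I) : I ≤ J := by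
  set D : FractionalIdeal (𝓞 F)⁰ F :=
    ∏ᶠ v : HeightOneSpectrum (𝓞 F), (v.asIdeal : FractionalIdeal (𝓞 F)⁰ F) ^ (count F v I - count F v J) with hD
  have hfin : ∀ᶠ v : HeightOneSpectrum (𝓞 F) in Filter.cofinite, count F v I - count F v J = 0 := by
    filter_upwards [finite_factors I, finite_factors J] with v h1 h2
    rw [h1, h2, sub_zero]
  have hDcount : ∀ v : HeightOneSpectrum (𝓞 F), count F v D = count F v I - count F v J :=
    fun v => count_finprod F v _ hfin
  have hD0 : D ≠ 0 := finprod_zpow_ne_zero _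
  have hIJD : I = J * D := eq_of_count_eq hI (mul_ne_zero hJ hD0) fun v => by
    rw [count_mul F v hJ hD0, hDcount]; ring
  have hD1 : D ≤ 1 := finprod_zpow_le_one _ fun v => sub_nonneg.mpr (h v)
  calc I = J * D := hIJD
    _ ≤ J * 1 := mul_le_mul_right hD1 J
    _ = J := mul_one J

/-- MEMBERSHIP is detected by orders: for `x ∈ F^×` and a nonzero fractional ideal `J`, `x ∈ J ⟺ count_v(J) ≤ ord_v(x)`
for all `v`. [cite: MochizukiAbsTopIII2015, Def 5.3 (i) p. 123] -/
theorem mem_iff_forall_count_le_ord {J : FractionalIdeal (𝓞 F)⁰ F} (hJ : J ≠ 0) {x : F} (hx : x ≠ 0) :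
    x ∈ J ↔ ∀ v : HeightOneSpectrum (𝓞 F), count F v J ≤ Literature.IUT.LogVolume.ord F v x := by
  have hx1 : spanSingleton (𝓞 F)⁰ x ≠ 0 := (spanSingleton_ne_zero_iff).mpr hx
  rw [← spanSingleton_le_iff_mem]
  constructor
  · intro hle v
    rw [← count_spanSingleton F v hx]
    exact count_mono F v hx1 hle
  · intro h
    exact le_of_count_le hx1 hJ fun v => (h v).trans_eq (count_spanSingleton F v hx).symm

/-- the fractional ideal with PRESCRIBED orders `e` (finitely supported): `x ∈ ∏ v^{e v} ⟺ e v ≤ ord_v(x)` for all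
`v`. [cite: MochizukiAbsTopIII2015, Def 5.3 (i) p. 123] -/
theorem mem_finprod_zpow_iff (e : HeightOneSpectrum (𝓞 F) → ℤ)
    (he : ∀ᶠ v : HeightOneSpectrum (𝓞 F) in Filter.cofinite, e v = 0) {x : F} (hx : x ≠ 0) :
    x ∈ ∏ᶠ v : HeightOneSpectrum (𝓞 F), (v.asIdeal : FractionalIdeal (𝓞 F)⁰ F) ^ e v ↔
      ∀ v : HeightOneSpectrum (𝓞 F), e v ≤ Literature.IUT.LogVolume.ord F v x := by
  rw [mem_iff_forall_count_le_ord (finprod_zpow_ne_zero e) hx]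
  refine forall_congr' fun v => ?_
  rw [count_finprod F v e he]

end LineBundleOrders

end Literature.AnabelianGeometry.AbsoluteAnabelian
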